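import Literature.MathematicalPhysics.QuantumLattice.MatrixProductStates
import HarnessLib

/-!
# Discharged fact: the AKLT tensor is normalised, `𝔼(1) = 1` (`MatrixProductStates`)

Sibling proof file of `Literature/MathematicalPhysics/QuantumLattice/MatrixProductStates.lean`
(next to `MatrixProductStatesProofs.lean`, `MatrixProductStatesAkltProofs.lean`,
`MatrixProductStatesAkltParentProofs.lean`). It discharges the named fact (`def X : Prop`, D-0014)

* `Literature.MathematicalPhysics.QuantumLattice.transferOp_akltTensor_one` — *the transfer
  operator of the AKLT tensor fixes the identity*, `𝔼(1) = Σ_σ A^σ (A^σ)† = 1`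
  (`transferOp_akltTensor_one_holds`);

no statement or definition is introduced or changed.

## Source

U. Schollwöck, Ann. Phys. **326** (2011) 96–192, §4.1.5 *The AKLT state as a matrix product
state*: the singlet-bond construction gives matrices `Ã^σ` with `Σ_σ (Ã^σ)† Ã^σ = ¾ I`, which
"should be rescaled by `2/√3`, such that we obtain normalized matrices `A`,
`A⁺ = [[0, √(2/3)], [0, 0]]`, `A⁰ = [[-1/√3, 0], [0, 1/√3]]`, `A⁻ = [[0, 0], [-√(2/3), 0]]`"
— exactly the vendored `akltTensor` (physical index `k ↦ m = 1 - k`). Schollwöck records the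
left-normalisation `Σ_σ (A^σ)† A^σ = 1`; the right-normalisation `Σ_σ A^σ (A^σ)† = 1` stated by
the fact (`𝔼(1) = 1` for the transfer operator `𝔼(X) = Σ_σ A^σ X (A^σ)†` of
Fannes–Nachtergaele–Werner, CMP **144** (1992), eq. (2.4)) holds for these matrices by the same
three-term computation, carried out below; equivalently the flattened identity is the
eigenvalue-`1` eigenvector of the `4 × 4` transfer matrix `E` printed in loc. cit.

## Proof

Entrywise `2 × 2` computation: `A⁺ (A⁺)† = (2/3) E₀₀`, `A⁰ (A⁰)† = (1/3)·1`,
`A⁻ (A⁻)† = (2/3) E₁₁`, and `2/3 + 1/3 = 1`. The only facts used about the constants are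
`√(2/3)·√(2/3) = 2/3` and `√(1/3)·√(1/3) = 1/3` (`Real.mul_self_sqrt`); the constants are then
generalised so that `simp` evaluates the matrix entries symbolically.

## References

* U. Schollwöck, *The density-matrix renormalization group in the age of matrix product
  states*, Ann. Phys. **326** (2011) 96–192, doi:10.1016/j.aop.2010.09.012, arXiv:1008.3477,
  §4.1.5.
* M. Fannes, B. Nachtergaele, R. F. Werner, *Finitely correlated states on quantum spin chains*,
  Comm. Math. Phys. **144** (1992) 443–490, §2 eq. (2.4) (transfer operator), §7 (AKLT example).
-/

noncomputable section

open Matrix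

namespace Literature.MathematicalPhysics.QuantumLattice

section QLattice

/-! ### The AKLT tensor is right-normalised -/

/-- **Discharge of `transferOp_akltTensor_one`.** `𝔼(1) = Σ_σ A^σ (A^σ)† = 1` for the AKLT
tensor: `A⁺ (A⁺)† = (2/3) diag(1,0)`, `A⁰ (A⁰)† = (1/3)·1`, `A⁻ (A⁻)† = (2/3) diag(0,1)` sum to
the identity. Schollwöck (2011) §4.1.5 prints these normalised matrices (rescaling `Ã` by
`2/√3`) together with the left-normalisation `Σ_σ (A^σ)† A^σ = 1`; the right-normalisation holds
by the same direct computation. [cite: Schollwock2011, §4.1.5] -/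
theorem transferOp_akltTensor_one_holds : transferOp_akltTensor_one := by
  unfold transferOp_akltTensor_one
  rw [transferOp_apply, Fin.sum_univ_three]
  ext i j
  simp only [Matrix.add_apply, Matrix.mul_apply, Matrix.conjTranspose_apply, Fin.sum_univ_two,
    Matrix.mul_one]
  simp only [akltTensor]
  -- the only facts needed about the normalisation constants
  have hr : ((Real.sqrt (2 / 3) : ℝ) : ℂ) * (Real.sqrt (2 / 3) : ℝ) = 2 / 3 := by
    rw [← Complex.ofReal_mul, Real.mul_self_sqrt (by positivity)]
    norm_num
  have hs : ((Real.sqrt (1 / 3) : ℝ) : ℂ) * (Real.sqrt (1 / 3) : ℝ) = 1 / 3 := by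
    rw [← Complex.ofReal_mul, Real.mul_self_sqrt (by positivity)]
    norm_num
  generalize Real.sqrt (2 / 3) = r at hr ⊢
  generalize Real.sqrt (1 / 3) = s at hs ⊢
  fin_cases i <;> fin_cases j <;> simp [hr, hs] <;> norm_num

end QLattice

end Literature.MathematicalPhysics.QuantumLattice
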